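import Summits.HodgeConjecture.CorCM.Census.QuarticInversionDictionary

/-!
# The quartic inversion twists: the datum from a cardinality count

COR-CM (cell `pub-hodgecm2`, stage 2 of the Hodge ladder), count-neutral KERNEL COMBINATORICS by the binder seat b23 (gen 44; claim
QUARTIC-INVERSION, HOME/INBOX.md l.12829).  A companion to `Census/QuarticInversionDictionary.lean` (BY NAME): theorems only; no `decide`,
no certificate, no named fact, no geometry, no `sorry`.  `Interfaces.lean` (C1), every E term, B01, `Transposition/*`, `PortJoin/*` untouched.
HONEST FRAMING: `HC_CM` is NOT proved, here or anywhere in the tree; nothing here is a period, a count of record or a headline.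

**Exhaustion from counting** (`exhaust_of_card`): for `ι : ℤ/2 × B → G` multiplicative and injective, `y ∉ ι(H₀)`, `t ∉ ι(H₀) ∪ y ι(H₀)` with
`y ι a = ι(−a) y`, `y² = ι(ζ,0)` and `|G| = 8|B|`, the four cosets `ι H₀, y ι H₀, t ι H₀, t y ι H₀` exhaust `G` — the remaining field of a
`Datum G c B ζ`, so that a datum can be assembled from automorphisms of a field and its degree (`CorCM/FaceQuarticInversionGeneration.lean`).
[folklore]
-/

namespace Summit.HodgeConjecture.CorCM.Census.QuarticInversion

variable {G : Type*} [Group G] [Fintype G] {A : Type} [AddCommGroup A] [Fintype A] {ζ : ZMod 2}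

/-- **Exhaustion from counting.** [folklore] -/
theorem exhaust_of_card (ι : ZMod 2 × A → G) (y t : G) (hι : ∀ a b, ι (a + b) = ι a * ι b) (hinj : Function.Injective ι)
    (hy : ∀ a, y * ι a = ι (-a) * y) (hyy : y * y = ι (ζ, 0)) (hy_ne : ∀ a, y ≠ ι a) (ht_ne : ∀ a, t ≠ ι a)
    (ht_ne' : ∀ a, t ≠ y * ι a) (hcard : Fintype.card G = 8 * Fintype.card A) :
    ∀ g : G, ∃ a, g = ι a ∨ g = y * ι a ∨ g = t * ι a ∨ g = t * (y * ι a) := by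
  classical
  have hι0 : ι 0 = 1 := by
    have h := hι 0 0
    rw [add_zero] at h
    exact mul_left_cancel (a := ι 0) (by rw [← h, mul_one])
  -- `ι a = g · ι b` forces `g = ι (a − b)`
  have hsub : ∀ (g : G) (a b : ZMod 2 × A), ι a = g * ι b → g = ι (a - b) := fun g a b h => by
    rw [sub_eq_add_neg, hι, h, mul_assoc, ← hι, add_neg_cancel, hι0, mul_one]
  have hyinv : y⁻¹ = y * ι (-(ζ, 0)) := by
    rw [inv_eq_iff_mul_eq_one, ← mul_assoc, hyy, ← hι, add_neg_cancel, hι0]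
  have hιy : ∀ a, ι a * y = y * ι (-a) := fun a => by rw [hy, neg_neg]
  -- the six disjointnesses
  have d01 : ∀ a b, ι a ≠ y * ι b := fun a b h => hy_ne _ (hsub _ _ _ h)
  have d02 : ∀ a b, ι a ≠ t * ι b := fun a b h => ht_ne _ (hsub _ _ _ h)
  have d12 : ∀ a b, y * ι a ≠ t * ι b := fun a b h => by
    have h' : ι a = y⁻¹ * t * ι b := by rw [mul_assoc, ← h, inv_mul_cancel_left]
    have h2 := hsub _ _ _ h'
    exact ht_ne' (a - b) (by rw [← h2, mul_inv_cancel_left])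
  have d03 : ∀ a b, ι a ≠ t * (y * ι b) := fun a b h => by
    rw [← mul_assoc] at h
    have h2 := hsub _ _ _ h
    apply ht_ne' (-(a - b) + -(ζ, 0))
    have h3 : t = ι (a - b) * y⁻¹ := by rw [← h2, mul_inv_cancel_right]
    rw [h3, hyinv, ← mul_assoc, hιy, mul_assoc, ← hι]
  have d13 : ∀ a b, y * ι a ≠ t * (y * ι b) := fun a b h => by
    have h' : ι a = y⁻¹ * t * y * ι b := by rw [mul_assoc, mul_assoc, ← h, inv_mul_cancel_left]
    have h2 := hsub _ _ _ h'
    apply ht_ne (-(a - b))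
    -- `y⁻¹ t y = ι (a − b)` so `t = y ι(a−b) y⁻¹ = ι(−(a−b))`
    have h3 : t = y * ι (a - b) * y⁻¹ := by rw [← h2, ← mul_assoc, ← mul_assoc, mul_inv_cancel, one_mul, mul_inv_cancel_right]
    rw [h3, hy, mul_assoc, mul_inv_cancel, mul_one]
  have d23 : ∀ a b, t * ι a ≠ t * (y * ι b) := fun a b h => d01 a b (mul_left_cancel h)
  -- the map from four copies of `ℤ/2 × B`
  set f : Fin 4 × (ZMod 2 × A) → G := fun p => ![ι p.2, y * ι p.2, t * ι p.2, t * (y * ι p.2)] p.1 with hf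
  have hfi : Function.Injective f := by
    rintro ⟨k, a⟩ ⟨k', b⟩ h
    fin_cases k <;> fin_cases k' <;>
      simp only [hf, Matrix.cons_val_zero, Matrix.cons_val_one, Matrix.cons_val_two, Matrix.cons_val_three, Matrix.head_cons,
        Matrix.tail_cons, Fin.zero_eta, Fin.mk_one, Fin.reduceFinMk] at h
    · rw [hinj h]
    · exact absurd h (d01 _ _)
    · exact absurd h (d02 _ _)
    · exact absurd h (d03 _ _)
    · exact absurd h.symm (d01 _ _)
    · rw [hinj (mul_left_cancel h)]
    · exact absurd h (d12 _ _)
    · exact absurd h (d13 _ _)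
    · exact absurd h.symm (d02 _ _)
    · exact absurd h.symm (d12 _ _)
    · rw [hinj (mul_left_cancel h)]
    · exact absurd h (d23 _ _)
    · exact absurd h.symm (d03 _ _)
    · exact absurd h.symm (d13 _ _)
    · exact absurd h.symm (d23 _ _)
    · rw [hinj (mul_left_cancel (mul_left_cancel h))]
  have hcard' : Fintype.card (Fin 4 × (ZMod 2 × A)) = Fintype.card G := by
    rw [Fintype.card_prod, Fintype.card_prod, Fintype.card_fin, ZMod.card, hcard]; ring
  have hfs : Function.Surjective f := ((Fintype.bijective_iff_injective_and_card f).mpr ⟨hfi, hcard'⟩).2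
  intro g
  obtain ⟨⟨k, a⟩, rfl⟩ := hfs g
  refine ⟨a, ?_⟩
  fin_cases k
  · exact Or.inl rfl
  · exact Or.inr (Or.inl rfl)
  · exact Or.inr (Or.inr (Or.inl rfl))
  · exact Or.inr (Or.inr (Or.inr rfl))

end Summit.HodgeConjecture.CorCM.Census.QuarticInversion
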